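import Summits.NavierStokesRegularity.NavierStokesRegularity.Theorems.SoloSalvageWu2026Flux
import Summits.NavierStokesRegularity.NavierStokesRegularity.Theorems.SoloSalvageWu2026Annulus
import Summits.NavierStokesRegularity.NavierStokesRegularity.Theorems.SoloSalvageWu2026LogMass
import HarnessLib

/-!
# C177 `Wu2026` — SALVAGE: the REDUCED composition — Theorem 1.1 of arXiv:2608.22471v1 from the
# EIGHT printed steps not yet ported (D-0090 NS-CLAIMS, LADDER row rung 3; salvage seat `ns-claims-salvage-p3`)

The skeleton's composition of record `Literature.Claims.NS.Wu2026.claim_of_steps''` (rev 2 p560520)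
derives `ClaimedTheorem := Literature.Analysis.FluidPDE.Wu2026_thm11` from TWELVE analytic binders
(`Step_L31`, `Step_D0` being proved in-file). Four of the twelve are now kernel theorems Summits-side,
typed exactly as the binders: `step_38` ((3.4)–(3.8), `SoloSalvageWu2026LogMass`), `step_318` ((3.18),
`SoloSalvageWu2026Annulus`), `step_386` ((3.86)) and `step_387` ((3.87), `SoloSalvageWu2026Flux`).
Substituting them leaves the named fact `Wu2026_thm11` as a consequence of EIGHT open analytic steps —
Lemma 2.1 (`Step_L21`: endpoint Biot–Savart / weak-Lorentz HLS + Seregin–Wang), (3.3) (`Step_33`: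
whole-space div–curl identity), §3.3 (`Step_341`: canonical pressure), §3.2–§3.4 (`Step_construct`: the
Euler blow-down tangent), Prop 3.3 (`Step_P33`: Bernoulli companion laws), Prop 3.4 (`Step_P34`: zero
tangent flux), (3.72)–(3.82) (`Step_382`: harmonic cut-off identity) and (3.83)–(3.85) (`Step_385`: passage
to the tangent current) — the remaining PORT for `Wu2026_thm11_holds`. Nothing here asserts any of them.

WHAT THIS IS NOT: not a claim about NS regularity or blow-up; not a claim about any author beyond the
typed locator.
-/

set_option linter.dupNamespace false

namespace Summit.NavierStokesRegularity.NavierStokesRegularity.Theorems.Wu2026Salvage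

open Literature.Claims.NS.Wu2026

/-- **Theorem 1.1 of arXiv:2608.22471v1 from the eight steps not yet ported** (Lemma 2.1, (3.3), §3.3,
§3.2–§3.4 tangent construction, Prop 3.3, Prop 3.4, (3.72)–(3.82), (3.83)–(3.85)); the steps (3.4)–(3.8),
Lemma 3.1, (3.18), (3.86), (3.87) and the `D = 0` case are kernel theorems. [cite: Wu2026, Thm 1.1 p.2 l.30–37; proof §3 p.7–26] -/
theorem claimedTheorem_of_open_steps (h21 : Step_L21) (h33 : Step_33) (h341 : Step_341)
    (hcon : Step_construct) (hP33 : Step_P33) (hP34 : Step_P34) (h382 : Step_382) (h385 : Step_385) :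
    ClaimedTheorem :=
  claim_of_steps'' h21 h33 step_38 step_318 h341 hcon hP33 hP34 h382 h385 step_386 step_387

/-- The same for the tree's named fact: `Wu2026_thm11` from the eight open steps.
[cite: Wu2026, Thm 1.1 p.2 l.30–37] -/
theorem wu2026_thm11_of_open_steps (h21 : Step_L21) (h33 : Step_33) (h341 : Step_341)
    (hcon : Step_construct) (hP33 : Step_P33) (hP34 : Step_P34) (h382 : Step_382) (h385 : Step_385) :
    Literature.Analysis.FluidPDE.Wu2026_thm11 :=
  claimedTheorem_of_open_steps h21 h33 h341 hcon hP33 hP34 h382 h385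

/-- And for Corollary 1.2 (the critical pointwise criterion without smallness), via the tree's PROVED
`Wu2026_cor12_of_thm11`. [cite: Wu2026, Cor 1.2 p.2 l.42–56] -/
theorem wu2026_cor12_of_open_steps (h21 : Step_L21) (h33 : Step_33) (h341 : Step_341)
    (hcon : Step_construct) (hP33 : Step_P33) (hP34 : Step_P34) (h382 : Step_382) (h385 : Step_385) :
    Literature.Analysis.FluidPDE.Wu2026_cor12 :=
  claimedCor_of_claimedTheorem (claimedTheorem_of_open_steps h21 h33 h341 hcon hP33 hP34 h382 h385)

end Summit.NavierStokesRegularity.NavierStokesRegularity.Theorems.Wu2026Salvage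

-- WHAT THIS IS NOT: not a claim about NS regularity or blow-up; not a claim about any author beyond the typed locator.
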